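import Literature.Computability.AlgebraicComplexity.MatrixMultiplicationExponent
import Mathlib.Analysis.Convex.Function
import HarnessLib

/-!
# The rectangular matrix multiplication exponents `ω(a, b, c)` and the dual exponent `α`

Definition request `defn-omegaRect` (route `MatrixMultiplication/RectangularAlpha`, wanted by
`stmt-MatrixMultiplication-0607`). In the conventions of `Literature.Computability.AlgebraicComplexity.omega`
(`MatrixMultiplicationExponent.lean`: coordinate tensors, tensor rank `R`, exponents as a
conditionally complete `sInf` over `ℝ`):

* `rectDim n a = ⌈n^a⌉₊` — the rectangular dimension;
* `rectAdmissibleExponents K a b c = {β | R(⟨⌈n^a⌉, ⌈n^b⌉, ⌈n^c⌉⟩) = O(n^β)}`;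
* `omegaRect K a b c = ω(a, b, c) = inf rectAdmissibleExponents K a b c` (Le Gall 2012, §1–§2:
  `ω(1, 1, k) = inf {τ | R(⟨n, n, ⌊n^k⌋⟩) = O(n^τ)}`; Le Gall–Urrutia 2018, §2.2 `ω(k)`;
  Christandl–Le Gall–Lysikov–Zuiddam, §1 footnote 1 `ω(p)` with `⌈n^p⌉`);
* `dualExponentAlpha K = α = sup {a ∈ [0, 1] | ω(1, a, 1) = 2}` (Le Gall 2012, §1:
  `α = sup {k | ω(1, 1, k) = 2}`; CLLZ §1: "the largest `p` such that `ω(p) = 2`").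

## Main results

* `omegaRect_one_one_one : ω(1,1,1) = ω` (proved);
* `max_mem_rectAdmissibleExponents` — the standard algorithm: `a⁺ + b⁺ + c⁺` is admissible, so the
  defining set is non-empty (proved);
* `omegaRect_mono_middle` — `a ≤ a' → ω(1,a,1) ≤ ω(1,a',1)`, from monotonicity of `R(⟨n,m,n⟩)` in
  `m` (a hypothesis here; proved problem-side in `RectangularAlpha/MonotoneMiddle.lean`) (proved);
* `omega_le_omegaRect_add` — `ω ≤ ω(1,a,1) + (1 − a)` for `a ≤ 1`, from monotonicity and the
  splitting bound `R(⟨n, mk, n⟩) ≤ k · R(⟨n, m, n⟩)` (hypotheses; the latter is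
  `RectangularAlpha/SplitMiddle.lean`) (proved);
* `dualExponentAlpha_le_one`, `dualExponentAlpha_nonneg`, `le_dualExponentAlpha` (proved);
* named fact `omegaRect_convexOn_middle` — convexity of `a ↦ ω(1,a,1)` (Lotti–Romani 1983;
  Le Gall 2012, §1), pending proof.
* **Current records** (cite item `wi-04482`, MatrixMultiplication survey), named facts over `ℂ`
  (the field of the summit `MatrixMultiplication`), upper bounds only, transcribed from the printed
  tables: `vxxz2024_omegaRect_table` (Vassilevska Williams–Xu–Xu–Zhou, SODA 2024, Table 1:
  `ω(1, κ, 1) ≤ …` for 24 values of `κ`, including `ω ≤ 2.371552`, `ω(1, 0.321334, 1) = 2`,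
  `μ ≤ 0.527661`, `ω(1,2,1) ≤ 3.250385`), `vxxz2024_alpha_ge` (`α ≥ 0.321334`),
  `advxxz2025_omegaRect_table` (Alman–Duan–Vassilevska Williams–Xu–Xu–Zhou, SODA 2025, Table 1:
  13 values, including `ω ≤ 2.371339`, `μ ≤ 0.527500`), with the square consequences drawn from
  the `κ = 1` rows: `ω(ℂ) ≤ 2.371552` (`vxxz2024_omegaRect_table.omega_le`, a proved implication; until
  2026-08-15 also the separate named fact `vxxz2024_omega_le`, merged back into the table fact by the
  D-0026 split review — a row of the table is not a separately proved result) and the named fact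
  `advxxz2025_omega_le : ω(ℂ) ≤ 2.371339` (row `k = 1` of the 2025 table, proved implication
  `advxxz2025_omegaRect_table.omega_le`).

## Design notes and wording risks

* **Rank, not border rank / arithmetic cost.** Le Gall 2012 §2 defines `ω(1,1,k)` via the rank
  `R(⟨n,n,⌊n^k⌋⟩)` and notes it equals the arithmetic-cost definition of §1; Le Gall–Urrutia use
  border rank. All give the same exponent (Bläser 2013, Thm. 5.2, §6); we follow `omega K` (rank).
* **`⌈n^a⌉` versus `⌊n^a⌋`.** CLLZ use `⌈n^p⌉`, Le Gall `⌊n^k⌋`; the exponents agree (both are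
  `n^{a+o(1)}` and `R(⟨n,m,n⟩)` is monotone in `m`). We use `⌈·⌉₊` (so all dimensions are `≥ 1`
  for `n ≥ 1`), and `rectDim n 1 = n` definitionally up to `simp`.
* **Which slot.** Le Gall puts `n^k` in the third slot, the route (`⟨n, m, n⟩`,
  `RectangularAlpha/*.lean`) in the middle. "It is well known (see, e.g., [Lotti–Romani]) that
  multiplying an `n × n` matrix by an `n × m` matrix, or an `m × n` matrix by an `n × n` matrix, can
  be done with the same number of arithmetic operations as multiplying an `n × m` matrix by an
  `m × n` matrix" (Le Gall 2012, §1), so `ω(1,1,k) = ω(1,k,1) = ω(k,1,1)`; we define the general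
  `ω(a,b,c)` and state the API for the middle slot `ω(1,a,1)`.
* `sInf`/`sSup` are the conditionally complete ones on `ℝ` (junk `0` on unbounded/empty sets), as
  for `omega K`; lower bounds (`BddBelow`, from flattening `R(⟨n,m,n⟩) ≥ n·m`) are hypotheses where
  needed, exactly as in `omega_le_three`.

## References

* F. Le Gall, *Faster algorithms for rectangular matrix multiplication*, FOCS 2012, §1 (`ω(1,1,k)`,
  `α`, (1), convexity), §2 (rank form). arXiv:1204.1111.
* F. Le Gall, F. Urrutia, *Improved rectangular matrix multiplication using powers of the
  Coppersmith–Winograd tensor*, SODA 2018, §1 (`α = sup{k | ω(k) = 2}`), §2.2 (`ω(k)`).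
* M. Christandl, F. Le Gall, V. Lysikov, J. Zuiddam, *Barriers for rectangular matrix
  multiplication*, comput. complexity (2025), §1 (footnote 1), §3.6. arXiv:2003.03019.
* G. Lotti, F. Romani, *On the asymptotic complexity of rectangular matrix multiplication*,
  Theoret. Comput. Sci. 23 (1983) 171–185 (convexity; source of Le Gall's (1)).
* V. Vassilevska Williams, Y. Xu, Z. Xu, R. Zhou, *New bounds for matrix multiplication: from
  alpha to omega*, SODA 2024, abstract and §1.1 Table 1 (p. 2 of arXiv:2307.07970v1), §8 (p. 52:
  "all bounds are obtained by analyzing the fourth power of the CW tensor with `q = 5`").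
* J. Alman, R. Duan, V. Vassilevska Williams, Y. Xu, Z. Xu, R. Zhou, *More asymmetry yields
  faster matrix multiplication*, SODA 2025, abstract, §1 Table 1 (p. 3 of arXiv:2404.16349), §7
  (p. 42: "`ω ≤ 2.371339` and `μ ≤ 0.527500`").
-/

noncomputable section

open Filter Asymptotics

namespace Literature.Computability.AlgebraicComplexity

universe u

/-! ## Rectangular dimensions `⌈n^a⌉` -/

/-- The rectangular dimension `⌈n^a⌉` (a natural number).
[cite: ChristandlLeGallLysikovZuiddam2025, §1 (footnote 1)] -/
def rectDim (n : ℕ) (a : ℝ) : ℕ :=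
  ⌈(n : ℝ) ^ a⌉₊

/-- `⌈n^1⌉ = n`. [folklore] -/
@[simp] theorem rectDim_one (n : ℕ) : rectDim n 1 = n := by
  simp [rectDim]

/-- `⌈n^0⌉ = 1`. [folklore] -/
@[simp] theorem rectDim_zero (n : ℕ) : rectDim n 0 = 1 := by
  simp [rectDim]

/-- For `n ≥ 1` every rectangular dimension is `≥ 1`. [folklore] -/
theorem one_le_rectDim {n : ℕ} (hn : 1 ≤ n) (a : ℝ) : 1 ≤ rectDim n a := by
  have hn' : (1 : ℝ) ≤ n := by exact_mod_cast hn
  rw [rectDim, Nat.one_le_ceil_iff]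
  exact Real.rpow_pos_of_pos (by linarith) _

/-- `⌈n^a⌉` is monotone in the exponent for `n ≥ 1`. [folklore] -/
theorem rectDim_mono {n : ℕ} (hn : 1 ≤ n) {a a' : ℝ} (h : a ≤ a') : rectDim n a ≤ rectDim n a' := by
  have hn' : (1 : ℝ) ≤ n := by exact_mod_cast hn
  exact Nat.ceil_mono (Real.rpow_le_rpow_of_exponent_le hn' h)

/-- The crude bound `⌈n^a⌉ ≤ 2 n^{max(a,0)}` for `n ≥ 1`. [folklore] -/
theorem rectDim_le {n : ℕ} (hn : 1 ≤ n) (a : ℝ) : (rectDim n a : ℝ) ≤ 2 * (n : ℝ) ^ max a 0 := by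
  have hn' : (1 : ℝ) ≤ n := by exact_mod_cast hn
  have h0 : (0 : ℝ) ≤ (n : ℝ) ^ a := Real.rpow_nonneg (by linarith) _
  have h1 : (n : ℝ) ^ a ≤ (n : ℝ) ^ max a 0 := Real.rpow_le_rpow_of_exponent_le hn' (le_max_left _ _)
  have h2 : (1 : ℝ) ≤ (n : ℝ) ^ max a 0 := Real.one_le_rpow hn' (le_max_right _ _)
  have h3 : (rectDim n a : ℝ) < (n : ℝ) ^ a + 1 := Nat.ceil_lt_add_one h0
  rw [rectDim] at h3 ⊢
  linarith

/-- `n ≤ ⌈n^a⌉ · ⌈n^{1-a}⌉`. [folklore] -/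
theorem le_rectDim_mul_rectDim (n : ℕ) (a : ℝ) : n ≤ rectDim n a * rectDim n (1 - a) := by
  rcases Nat.eq_zero_or_pos n with rfl | hn
  · exact Nat.zero_le _
  have hn' : (0 : ℝ) < n := by exact_mod_cast hn
  have h : (n : ℝ) ≤ (rectDim n a * rectDim n (1 - a) : ℕ) := by
    calc (n : ℝ) = (n : ℝ) ^ a * (n : ℝ) ^ (1 - a) := by
          rw [← Real.rpow_add hn', add_sub_cancel, Real.rpow_one]
      _ ≤ (rectDim n a : ℝ) * (rectDim n (1 - a) : ℝ) :=
          mul_le_mul (Nat.le_ceil _) (Nat.le_ceil _) (Real.rpow_nonneg hn'.le _) (Nat.cast_nonneg _)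
      _ = _ := by push_cast; rfl
  exact_mod_cast h

/-! ## Rectangular exponents -/

section Rect

variable (K : Type u) [CommSemiring K]

/-- Reindexing the three dimensions along equalities does not change the rank (transport).
[folklore] -/
theorem tensorRank_matMulTensor_congr {k k' m m' n n' : ℕ} (hk : k = k') (hm : m = m')
    (hn : n = n') : tensorRank (matMulTensor K k m n) = tensorRank (matMulTensor K k' m' n') := by
  subst hk; subst hm; subst hn; rfl

/-- The admissible exponents of `(a, b, c)`-rectangular matrix multiplication,
`{β | R(⟨⌈n^a⌉, ⌈n^b⌉, ⌈n^c⌉⟩) = O(n^β)}` (rank form, as in Le Gall 2012, §2).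
[cite: LeGall2012, §2 (rank form of ω(1,1,k))] -/
def rectAdmissibleExponents (a b c : ℝ) : Set ℝ :=
  {β : ℝ | (fun n : ℕ => (tensorRank (matMulTensor K (rectDim n a) (rectDim n b) (rectDim n c)) : ℝ))
    =O[atTop] fun n : ℕ => (n : ℝ) ^ β}

/-- **The rectangular matrix multiplication exponent**
`ω(a, b, c) = inf {β | R(⟨⌈n^a⌉, ⌈n^b⌉, ⌈n^c⌉⟩) = O(n^β)}` over `K`; `ω(1,1,k)` of Le Gall 2012,
`ω(k)` of Le Gall–Urrutia 2018 §2.2 and `ω(p)` of CLLZ are `omegaRect K 1 1 k` (equivalently, by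
the well-known symmetry, `omegaRect K 1 k 1`). A conditionally complete infimum over `ℝ` (junk `0`
if the set were unbounded below). [cite: LeGall2012, §1–§2] -/
def omegaRect (a b c : ℝ) : ℝ :=
  sInf (rectAdmissibleExponents K a b c)

/-- **The dual exponent of matrix multiplication** `α = sup {a ∈ [0,1] | ω(1, a, 1) = 2}`
(Le Gall 2012, §1: `α = sup{k | ω(1,1,k) = 2}`; CLLZ: "the largest `p` such that `ω(p) = 2`";
`ω = 2 ↔ α = 1`). A conditionally complete supremum over `ℝ` (value `0` on the empty set).
[cite: LeGallUrrutia2018, §1 (α = sup{k | ω(k) = 2})] -/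
def dualExponentAlpha : ℝ :=
  sSup {a : ℝ | a ∈ Set.Icc (0 : ℝ) 1 ∧ omegaRect K 1 a 1 = 2}

/-- For `(a,b,c) = (1,1,1)` the admissible exponents are those of `omega K`. [folklore] -/
theorem rectAdmissibleExponents_one_one_one :
    rectAdmissibleExponents K 1 1 1 = admissibleExponents K := by
  have hf : (fun n : ℕ =>
      (tensorRank (matMulTensor K (rectDim n 1) (rectDim n 1) (rectDim n 1)) : ℝ)) =
      fun n : ℕ => (tensorRank (matMulTensor K n n n) : ℝ) :=
    funext fun n => by
      rw [tensorRank_matMulTensor_congr K (rectDim_one n) (rectDim_one n) (rectDim_one n)]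
  ext β
  simp only [rectAdmissibleExponents, admissibleExponents, Set.mem_setOf_eq, hf]

/-- **`ω(1,1,1) = ω`.** [cite: LeGall2012, §1 (ω = ω(1,1,1))] -/
theorem omegaRect_one_one_one : omegaRect K 1 1 1 = omega K := by
  rw [omegaRect, rectAdmissibleExponents_one_one_one]
  rfl

variable {K}

/-- Rectangular admissible exponents are upward closed. [folklore] -/
theorem mem_rectAdmissibleExponents_of_le {a b c β γ : ℝ}
    (hβ : β ∈ rectAdmissibleExponents K a b c) (h : β ≤ γ) : γ ∈ rectAdmissibleExponents K a b c := by
  refine hβ.trans ?_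
  refine IsBigO.of_bound 1 ?_
  filter_upwards [eventually_ge_atTop 1] with n hn
  have hn' : (1 : ℝ) ≤ n := by exact_mod_cast hn
  rw [one_mul, Real.norm_of_nonneg (Real.rpow_nonneg (by positivity) _),
    Real.norm_of_nonneg (Real.rpow_nonneg (by positivity) _)]
  exact Real.rpow_le_rpow_of_exponent_le hn' h

variable (K)

/-- **The standard algorithm**: `R(⟨⌈n^a⌉,⌈n^b⌉,⌈n^c⌉⟩) ≤ ⌈n^a⌉⌈n^b⌉⌈n^c⌉ ≤ 8 n^{a⁺+b⁺+c⁺}`, so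
`a⁺ + b⁺ + c⁺` is an admissible exponent. [cite: Blaser2013, §5] -/
theorem max_mem_rectAdmissibleExponents (a b c : ℝ) :
    max a 0 + max b 0 + max c 0 ∈ rectAdmissibleExponents K a b c := by
  refine IsBigO.of_bound 8 ?_
  filter_upwards [eventually_ge_atTop 1] with n hn
  have hn0 : (0 : ℝ) < n := by exact_mod_cast hn
  rw [Real.norm_of_nonneg (Nat.cast_nonneg _),
    Real.norm_of_nonneg (Real.rpow_nonneg hn0.le _)]
  have h := tensorRank_matMulTensor_le K (rectDim n a) (rectDim n b) (rectDim n c)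
  calc (tensorRank (matMulTensor K (rectDim n a) (rectDim n b) (rectDim n c)) : ℝ)
      ≤ (rectDim n a * rectDim n b * rectDim n c : ℕ) := by exact_mod_cast h
    _ = (rectDim n a : ℝ) * rectDim n b * rectDim n c := by push_cast; ring
    _ ≤ (2 * (n : ℝ) ^ max a 0) * (2 * (n : ℝ) ^ max b 0) * (2 * (n : ℝ) ^ max c 0) := by
        gcongr
        · exact rectDim_le hn a
        · exact rectDim_le hn b
        · exact rectDim_le hn c
    _ = 8 * (n : ℝ) ^ (max a 0 + max b 0 + max c 0) := by
        rw [Real.rpow_add hn0, Real.rpow_add hn0]; ring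

/-- The set of admissible rectangular exponents is non-empty. [folklore] -/
theorem rectAdmissibleExponents_nonempty (a b c : ℝ) : (rectAdmissibleExponents K a b c).Nonempty :=
  ⟨_, max_mem_rectAdmissibleExponents K a b c⟩

/-- `ω(a,b,c) ≤ a⁺ + b⁺ + c⁺` once the admissible set is bounded below (e.g. by flattening).
[cite: Blaser2013, §5] -/
theorem omegaRect_le_max {a b c : ℝ} (h : BddBelow (rectAdmissibleExponents K a b c)) :
    omegaRect K a b c ≤ max a 0 + max b 0 + max c 0 :=
  csInf_le h (max_mem_rectAdmissibleExponents K a b c)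

/-! ### The middle slot `ω(1, a, 1)` -/

/-- Monotonicity of `R(⟨n,m,n⟩)` in `m` (proved problem-side, `RectangularAlpha/MonotoneMiddle`)
makes the admissible sets antitone in `a`. [folklore] -/
theorem rectAdmissibleExponents_anti_middle
    (hmono : ∀ n m m' : ℕ, m ≤ m' →
      tensorRank (matMulTensor K n m n) ≤ tensorRank (matMulTensor K n m' n))
    {a a' : ℝ} (h : a ≤ a') :
    rectAdmissibleExponents K 1 a' 1 ⊆ rectAdmissibleExponents K 1 a 1 := by
  intro β hβ
  refine IsBigO.trans ?_ hβ
  refine IsBigO.of_bound 1 ?_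
  filter_upwards [eventually_ge_atTop 1] with n hn
  rw [one_mul, Real.norm_of_nonneg (Nat.cast_nonneg _), Real.norm_of_nonneg (Nat.cast_nonneg _)]
  exact_mod_cast hmono (rectDim n 1) _ _ (rectDim_mono hn h)

/-- **`ω(1,a,1)` is monotone in `a`** (given monotonicity of `R(⟨n,m,n⟩)` in `m` and a lower bound
for the admissible set). [cite: LeGall2012, §1] -/
theorem omegaRect_mono_middle
    (hmono : ∀ n m m' : ℕ, m ≤ m' →
      tensorRank (matMulTensor K n m n) ≤ tensorRank (matMulTensor K n m' n))
    {a a' : ℝ} (hbdd : BddBelow (rectAdmissibleExponents K 1 a 1)) (h : a ≤ a') :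
    omegaRect K 1 a 1 ≤ omegaRect K 1 a' 1 :=
  csInf_le_csInf hbdd (rectAdmissibleExponents_nonempty K 1 a' 1)
    (rectAdmissibleExponents_anti_middle K hmono h)

/-- **Splitting the middle dimension**: if `β` is admissible for `⟨n, ⌈n^a⌉, n⟩` (`a ≤ 1`) then
`β + (1 − a)` is admissible for `⟨n,n,n⟩`, since
`R(⟨n,n,n⟩) ≤ R(⟨n, ⌈n^a⌉⌈n^{1-a}⌉, n⟩) ≤ ⌈n^{1-a}⌉ · R(⟨n, ⌈n^a⌉, n⟩)` (monotonicity and the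
block decomposition `RectangularAlpha/SplitMiddle`, both hypotheses here).
[cite: LeGall2012, §1 (1)] -/
theorem add_mem_admissibleExponents_of_mem_rect
    (hmono : ∀ n m m' : ℕ, m ≤ m' →
      tensorRank (matMulTensor K n m n) ≤ tensorRank (matMulTensor K n m' n))
    (hsplit : ∀ n m k : ℕ,
      tensorRank (matMulTensor K n (m * k) n) ≤ k * tensorRank (matMulTensor K n m n))
    {a β : ℝ} (ha : a ≤ 1) (hβ : β ∈ rectAdmissibleExponents K 1 a 1) :
    β + (1 - a) ∈ admissibleExponents K := by
  obtain ⟨C, hC0, hC⟩ := hβ.exists_nonneg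
  refine IsBigO.of_bound (2 * C) ?_
  filter_upwards [hC.bound, eventually_ge_atTop 1] with n hCn hn
  have hn0 : (0 : ℝ) < n := by exact_mod_cast hn
  rw [Real.norm_of_nonneg (Nat.cast_nonneg _), Real.norm_of_nonneg (Real.rpow_nonneg hn0.le _)]
    at hCn ⊢
  rw [tensorRank_matMulTensor_congr K (rectDim_one n) rfl (rectDim_one n)] at hCn
  have h1 := hmono n n _ (le_rectDim_mul_rectDim n a)
  have h2 := hsplit n (rectDim n a) (rectDim n (1 - a))
  have hk : (rectDim n (1 - a) : ℝ) ≤ 2 * (n : ℝ) ^ (1 - a) := by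
    simpa [max_eq_left (sub_nonneg.mpr ha)] using rectDim_le hn (1 - a)
  calc (tensorRank (matMulTensor K n n n) : ℝ)
      ≤ (rectDim n (1 - a) * tensorRank (matMulTensor K n (rectDim n a) n) : ℕ) := by
        exact_mod_cast h1.trans h2
    _ = (rectDim n (1 - a) : ℝ) * tensorRank (matMulTensor K n (rectDim n a) n) := by push_cast; ring
    _ ≤ (2 * (n : ℝ) ^ (1 - a)) * (C * (n : ℝ) ^ β) :=
        mul_le_mul hk hCn (Nat.cast_nonneg _) (by positivity)
    _ = 2 * C * (n : ℝ) ^ (β + (1 - a)) := by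
        rw [Real.rpow_add hn0]; ring

/-- **`ω ≤ ω(1, a, 1) + (1 − a)`** for `a ≤ 1` (given monotonicity, splitting, and a lower bound for
the admissible exponents of `ω`). [cite: LeGall2012, §1 (1)] -/
theorem omega_le_omegaRect_add
    (hmono : ∀ n m m' : ℕ, m ≤ m' →
      tensorRank (matMulTensor K n m n) ≤ tensorRank (matMulTensor K n m' n))
    (hsplit : ∀ n m k : ℕ,
      tensorRank (matMulTensor K n (m * k) n) ≤ k * tensorRank (matMulTensor K n m n))
    (hbdd : BddBelow (admissibleExponents K)) {a : ℝ} (ha : a ≤ 1) :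
    omega K ≤ omegaRect K 1 a 1 + (1 - a) := by
  rw [omegaRect, ← sub_le_iff_le_add]
  refine le_csInf (rectAdmissibleExponents_nonempty K 1 a 1) fun β hβ => ?_
  rw [sub_le_iff_le_add]
  exact csInf_le hbdd (add_mem_admissibleExponents_of_mem_rect K hmono hsplit ha hβ)

/-! ### The dual exponent -/

/-- `α ≤ 1`. [cite: LeGall2012, §1] -/
theorem dualExponentAlpha_le_one : dualExponentAlpha K ≤ 1 :=
  Real.sSup_le (fun _ ha => ha.1.2) zero_le_one

/-- `0 ≤ α`. [cite: LeGall2012, §1] -/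
theorem dualExponentAlpha_nonneg : 0 ≤ dualExponentAlpha K :=
  Real.sSup_nonneg fun _ ha => ha.1.1

/-- Lower bounds on `α`: if `ω(1, a, 1) = 2` for some `a ∈ [0,1]` then `a ≤ α`.
[cite: LeGall2012, §1 (Thm 1.1 ⇒ α > 0.30298)] -/
theorem le_dualExponentAlpha {a : ℝ} (ha : a ∈ Set.Icc (0 : ℝ) 1) (h : omegaRect K 1 a 1 = 2) :
    a ≤ dualExponentAlpha K :=
  le_csSup ⟨1, fun _ hx => hx.1.2⟩ ⟨ha, h⟩

end Rect

/-! ## Named fact: convexity -/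

/-- **Convexity of `k ↦ ω(1, k, 1)` on `[0, ∞)`** (Lotti–Romani 1983; used in Le Gall 2012, §1:
"exploit the convexity of the function `ω(1,1,k)`", whence for `0 ≤ k₀ < 1` and `k₀ ≤ k ≤ 1`,
`ω(1,1,k) ≤ ω(1,1,k₀) + (ω − ω(1,1,k₀)) (k − k₀)/(1 − k₀)`). Stated for the middle slot, which has
the same exponent (Le Gall 2012, §1). Pending proof (Kronecker submultiplicativity + Hölder-type
interpolation of the dimensions). [cite: LeGall2012, §1 (convexity of ω(1,1,k))] -/
def omegaRect_convexOn_middle : Prop :=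
  ∀ (K : Type) [Field K], ConvexOn ℝ (Set.Ici (0 : ℝ)) fun k => omegaRect K 1 k 1

/-- Le Gall's printed consequence of convexity: for `0 ≤ k₀ < 1` and `k₀ ≤ k ≤ 1`,
`ω(1,k,1) ≤ ω(1,k₀,1) + (ω − ω(1,k₀,1)) · (k − k₀)/(1 − k₀)`. [cite: LeGall2012, §1] -/
theorem omegaRect_convexOn_middle.interpolation (h : omegaRect_convexOn_middle) (K : Type) [Field K]
    {k₀ k : ℝ} (h₀ : 0 ≤ k₀) (h₁ : k₀ < 1) (hk₀ : k₀ ≤ k) (hk₁ : k ≤ 1) :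
    omegaRect K 1 k 1 ≤
      omegaRect K 1 k₀ 1 + (omega K - omegaRect K 1 k₀ 1) * ((k - k₀) / (1 - k₀)) := by
  have hc := h K
  set t : ℝ := (k - k₀) / (1 - k₀) with ht
  have h1k : 0 < 1 - k₀ := by linarith
  have ht0 : 0 ≤ t := div_nonneg (by linarith) h1k.le
  have ht1 : t ≤ 1 := (div_le_one h1k).mpr (by linarith)
  have hk : k = (1 - t) • k₀ + t • (1 : ℝ) := by
    simp only [smul_eq_mul, ht]
    field_simp
    ring
  have := hc.2 (Set.mem_Ici.mpr h₀) (Set.mem_Ici.mpr zero_le_one) (sub_nonneg.mpr ht1) ht0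
    (by ring)
  rw [← hk] at this
  simp only [smul_eq_mul, omegaRect_one_one_one] at this
  exact this.trans_eq (by ring)

/-! ## Current records (2024–2025): named facts over `ℂ`

Upper bounds obtained by the laser method (asymmetric hashing) on the fourth Kronecker power of the
Coppersmith–Winograd tensor `CW_5`.  The papers work in the arithmetic circuit model over a field
and state the bounds without naming the field; they are vendored over `ℂ`, the field of the summit
`MatrixMultiplication` (`ω(K)` depends only on the characteristic).  Numerical values are exactly
the printed (rounded-up) table entries, as non-strict inequalities `≤` (the abstracts print
`ω ≤ 2.371552`, resp. `ω < 2.371339`; the tables are headed "upper bound on `ω(1, κ, 1)`").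
The papers' `ω(1, κ, 1)` is the arithmetic-cost exponent, equal to the rank exponent
`omegaRect ℂ 1 κ 1` (Le Gall 2012, §2; Bläser 2013, Thm. 5.2). -/

section Records

/-- **Table 1 of Vassilevska Williams–Xu–Xu–Zhou (SODA 2024)**: the pairs `(κ, b)` with printed
upper bound `ω(1, κ, 1) ≤ b` ("our bounds on `ω(1, κ, 1)` by analyzing the fourth power of the CW
tensor").  Row `κ = 1` is `ω ≤ 2.371552`; row `κ = 0.321334`, `b = 2` is `α ≥ 0.321334`; row
`κ = 0.527661`, `b = 2.055322 = 1 + 2κ` is `μ ≤ 0.527661`; row `κ = 2` is `ω(1,2,1) ≤ 3.250385`.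
[cite: VassilevskaWilliamsXuXuZhou2024, §1.1 Table 1] -/
def vxxz2024Table : List (ℝ × ℝ) :=
  [(0.321334, 2), (0.33, 2.000100), (0.34, 2.000600), (0.35, 2.001363), (0.40, 2.009541),
    (0.45, 2.023788), (0.50, 2.042994), (0.527661, 2.055322), (0.55, 2.066134), (0.60, 2.092631),
    (0.65, 2.121734), (0.70, 2.153048), (0.75, 2.186210), (0.80, 2.220929), (0.85, 2.256984),
    (0.90, 2.294209), (0.95, 2.332440), (1.00, 2.371552), (1.10, 2.452056), (1.20, 2.535063),
    (1.50, 2.794941), (2.00, 3.250385), (2.50, 3.720468), (3.00, 4.198809)]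

/-- **Vassilevska Williams–Xu–Xu–Zhou 2024, rectangular bounds** (SODA 2024, §1.1, Table 1): for
every row `(κ, b)` of Table 1, `ω(1, κ, 1) ≤ b` (over `ℂ`).  In particular `ω ≤ 2.371552`,
`μ ≤ 0.527661`, `ω(1, 2, 1) ≤ 3.250385`.  Named fact (statement only; a computer-assisted
optimisation over the fourth power of `CW_5`, §8). [cite: VassilevskaWilliamsXuXuZhou2024, §1.1 Table 1] -/
def vxxz2024_omegaRect_table : Prop :=
  ∀ κ b : ℝ, (κ, b) ∈ vxxz2024Table → omegaRect ℂ 1 κ 1 ≤ b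

/-- **Vassilevska Williams–Xu–Xu–Zhou 2024, the dual exponent** (SODA 2024, abstract and §1.1):
`α ≥ 0.321334` (improved from `α ≥ 0.31389`, Le Gall–Urrutia 2018), where `α` is the largest
value with `ω(1, α, 1) = 2` (`dualExponentAlpha`).  Named fact (statement only).
[cite: VassilevskaWilliamsXuXuZhou2024, abstract and §1.1] -/
def vxxz2024_alpha_ge : Prop :=
  (0.321334 : ℝ) ≤ dualExponentAlpha ℂ

/-- **Vassilevska Williams–Xu–Xu–Zhou 2024, square bound** (SODA 2024, abstract): `ω ≤ 2.371552`
over `ℂ` (improved from `ω ≤ 2.371866`, Duan–Wu–Zhou 2023) — row `κ = 1` of Table 1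
(`vxxz2024_omegaRect_table`; `ω(1,1,1) = ω`, `omegaRect_one_one_one`), a proved implication.  Until
2026-08-15 the conclusion was also vendored as the separate named fact `vxxz2024_omega_le : Prop`; the
D-0026 split review MERGED it back into the table fact: it is a row of the table, not a separately
proved statement, and its only discharge is the table's — layer (T), the asymmetric-hashing laser
method of §4–§7, applied to layer (C), the published `κ = 1` parameter vector of §8
(`RectangularExponentCert.lean`, `RectangularExponentCertReduction.lean`: the single trust base
`CW5DegenerationCertificate vxxz2024TableCertified`, with the proved consequences
`vxxz2024_omegaRect_table_certified.omega_le`, `vxxz2024_omega_le_of_cw5Certificate`,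
`vxxz2024_omega_le_of_forall_polyDegeneratesTo`, all concluding `ω(ℂ) ≤ 2.371552` inline).  The best
square bound PROVED in the tree is `LeGall2014_cw4_omega_le : ω ≤ 2.37295` (`BigCwFourthOmega.lean`).
[cite: VassilevskaWilliamsXuXuZhou2024, abstract and §1.1 Table 1 (row κ = 1)] -/
theorem vxxz2024_omegaRect_table.omega_le (h : vxxz2024_omegaRect_table) : omega ℂ ≤ 2.371552 := by
  have := h 1 2.371552 (by norm_num [vxxz2024Table])
  rwa [omegaRect_one_one_one] at this

/-- Row `κ = 2` of Table 1: `ω(1, 2, 1) ≤ 3.250385` (4-clique detection exponent). [cite: VassilevskaWilliamsXuXuZhou2024, §1.1 Table 1] -/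
theorem vxxz2024_omegaRect_table.one_two_one (h : vxxz2024_omegaRect_table) :
    omegaRect ℂ 1 2 1 ≤ 3.250385 :=
  h 2 3.250385 (by norm_num [vxxz2024Table])

/-- Row `κ = 0.321334` of Table 1: `ω(1, 0.321334, 1) ≤ 2`. [cite: VassilevskaWilliamsXuXuZhou2024, §1.1 Table 1] -/
theorem vxxz2024_omegaRect_table.alpha_row (h : vxxz2024_omegaRect_table) :
    omegaRect ℂ 1 0.321334 1 ≤ 2 :=
  h 0.321334 2 (by norm_num [vxxz2024Table])

/-- From the `κ = 0.321334` row and the (flattening) lower bound `ω(1, 0.321334, 1) ≥ 2`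
(hypothesis), `α ≥ 0.321334` follows by `le_dualExponentAlpha`. [cite: VassilevskaWilliamsXuXuZhou2024, §1.1] -/
theorem vxxz2024_omegaRect_table.alpha_ge (h : vxxz2024_omegaRect_table)
    (hlow : 2 ≤ omegaRect ℂ 1 0.321334 1) : vxxz2024_alpha_ge :=
  le_dualExponentAlpha ℂ ⟨by norm_num, by norm_num⟩ (le_antisymm h.alpha_row hlow)

/-- **Table 1 of Alman–Duan–Vassilevska Williams–Xu–Xu–Zhou (SODA 2025)**: the pairs `(k, b)`
with printed upper bound `ω(1, k, 1) ≤ b` ("our bounds on `ω(1, k, 1)` from the fourth-power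
analysis of the CW tensor").  Row `k = 1` is `ω ≤ 2.371339`; row `k = 0.5275`, `b = 2.054999`
(`< 1 + 2k = 2.055`) gives `μ ≤ 0.527500`. [cite: AlmanDuanVassilevskaWilliamsXuXuZhou2025, §1 Table 1] -/
def advxxz2025Table : List (ℝ × ℝ) :=
  [(0.33, 2.000092), (0.34, 2.000520), (0.35, 2.001243), (0.40, 2.009280), (0.50, 2.042776),
    (0.527500, 2.054999), (0.60, 2.092351), (0.70, 2.152770), (0.80, 2.220639), (0.90, 2.293941),
    (1.00, 2.371339), (1.50, 2.794633), (2.00, 3.250035)]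

/-- **Alman–Duan–Vassilevska Williams–Xu–Xu–Zhou 2025, rectangular bounds** (SODA 2025, §1,
Table 1): for every row `(k, b)` of Table 1, `ω(1, k, 1) ≤ b` (over `ℂ`).  Named fact (statement
only; fourth power of `CW_5`, §7). [cite: AlmanDuanVassilevskaWilliamsXuXuZhou2025, §1 Table 1] -/
def advxxz2025_omegaRect_table : Prop :=
  ∀ k b : ℝ, (k, b) ∈ advxxz2025Table → omegaRect ℂ 1 k 1 ≤ b

/-- **Alman–Duan–Vassilevska Williams–Xu–Xu–Zhou 2025, square bound** (SODA 2025, abstract;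
§7: "`ω ≤ 2.371339`"): `ω ≤ 2.371339` over `ℂ`, the current record (improved from
`ω ≤ 2.371552`).  Row `k = 1` of `advxxz2025_omegaRect_table`. [cite: AlmanDuanVassilevskaWilliamsXuXuZhou2025, abstract] -/
def advxxz2025_omega_le : Prop :=
  omega ℂ ≤ 2.371339

/-- The square record is the `k = 1` row of the 2025 table. [cite: AlmanDuanVassilevskaWilliamsXuXuZhou2025, §1 Table 1] -/
theorem advxxz2025_omegaRect_table.omega_le (h : advxxz2025_omegaRect_table) :
    advxxz2025_omega_le := by
  have := h 1 2.371339 (by norm_num [advxxz2025Table])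
  rwa [omegaRect_one_one_one] at this

/-- The 2025 square record implies the 2024 one, `ω ≤ 2.371552`. [folklore] -/
theorem advxxz2025_omega_le.vxxz2024 (h : advxxz2025_omega_le) : omega ℂ ≤ 2.371552 :=
  le_trans (α := ℝ) h (by norm_num)

/-- Row `k = 2` of the 2025 table: `ω(1, 2, 1) ≤ 3.250035`. [cite: AlmanDuanVassilevskaWilliamsXuXuZhou2025, §1 Table 1] -/
theorem advxxz2025_omegaRect_table.one_two_one (h : advxxz2025_omegaRect_table) :
    omegaRect ℂ 1 2 1 ≤ 3.250035 :=
  h 2 3.250035 (by norm_num [advxxz2025Table])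

end Records

end Literature.Computability.AlgebraicComplexity
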